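import Mathlib.RingTheory.PowerSeries.Substitution
import Mathlib.RingTheory.PowerSeries.Expand
import Mathlib.Algebra.CharP.Quotient
import Mathlib.Algebra.CharP.Frobenius
import Mathlib.Algebra.Ring.GeomSum
import HarnessLib

/-!
# Dwork's integrality lemma with a Frobenius endomorphism of the coefficients and a Frobenius
# lift of the variable

Topic `RingTheory/FormalGroups` (proofs only; no definitions, no named facts). First of two files
vendoring the integrality engine of Blakestad–Grant's construction of the universal `p`-adic sigma
function of Mazur–Tate (J. Number Theory 249 (2023), §2.2: Lemma 5 = Hazewinkel's functional
equation lemma, Cor. 6 (a)–(c), the tool of their Thm. 1), for the discharge of the tree's named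
fact `WeierstrassCurve.mazur_tate_sigma_existsUnique` (Mazur–Stein–Tate 2006, Thm. 1.3, existence
half). The sequel `FunctionalEquationIntegrality.lean` derives Cor. 6 from the lemma proved here.

The setting (Blakestad–Grant: `R̂` the `p`-completion of `ℤ[1/6][A₄, A₆][1/H]`, `K = R̂ ⊗ ℚ`,
`α : R̂ → R̂` an endomorphism with `α(r) ≡ rᵖ (mod p)`, Def. 8) is abstracted as: a commutative
ring `K` in which `p` is a unit, a subring `A ≤ K` with `K = A[1/p]` (every `x ∈ K` has
`pᵏx ∈ A` for some `k`), and a ring endomorphism `α` of `K` with `α(A) ⊆ A` and `α(r) - rᵖ ∈ pA`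
for `r ∈ A`. "`f ∈ A⟦X⟧`" is `∀ n, coeff n f ∈ A`; congruences modulo `p` are spelled out
coefficientwise.

* `coeff_mem_of_map_subst_eq_pow_mul` — **Dwork's lemma with a Frobenius endomorphism `α` and a
  Frobenius lift `φ ≡ Xᵖ (mod p)`, `φ(0) = 0`**: if `s ∈ 1 + XK⟦X⟧` has `[X¹]s ∈ A` and
  `(α_* s)(φ) = sᵖ · u` with `u ∈ 1 + pXA⟦X⟧`, then `s ∈ A⟦X⟧`. Koblitz, GTM 58, Ch. IV §2,
  Lemma 3 ("Dwork's lemma": `F(Xᵖ)/F(X)ᵖ ∈ 1 + pXℤ_p⟦X⟧ ⇒ F ∈ 1 + Xℤ_p⟦X⟧`) is the case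
  `A = ℤ_p`, `α = id`, `φ = Xᵖ` (in the tree for `ℚ_p` as
  `Literature.NumberTheory.LFunctions.Dwork.norm_coeff_le_one_of_expand_eq`). Proof: Koblitz's
  coefficient induction. Modulo `p`, `(α_* s_{<n})(φ) ≡ (α_* s_{<n})(Xᵖ) ≡ (s_{<n})ᵖ`
  (`map_mk_subst_X_pow_map_eq_pow`: Frobenius on `(A/p)⟦X⟧`, Mathlib's
  `MvPowerSeries.map_frobenius_expand`); comparing coefficients of `Xⁿ` (`n ≥ 2`) in
  `(α_* s)(φ) = sᵖu` with `s = s_{<n} + Xⁿr` gives `sₙ = a + pⁿ⁻¹(φ₁/p)ⁿ α(sₙ)`, `a ∈ A`, and then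
  `sₙ ∈ A` by descent on `k` in `pᵏsₙ ∈ A` (`mem_of_eq_add_pow_mul_map`). The case `p ∈ Aˣ`
  (so `A = K`) is trivial and treated separately (it is excluded by `CharP (A/p) p`).

## Sources

* C. Blakestad, D. Grant, *On the universal `p`-adic sigma and Weierstrass zeta functions*,
  J. Number Theory 249 (2023) 348–376 (arXiv:1903.02480), §2.2, Lemma 5 and Cor. 6; Def. 8.
  [BlakestadGrant2023]
* N. Koblitz, *p-adic Numbers, p-adic Analysis, and Zeta-Functions*, GTM 58 (1984), Ch. IV §2,
  Lemma 3 and its proof. [Koblitz1984]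
* M. Hazewinkel, *Formal Groups and Applications* (1978), Ch. I §2.2 (functional equation lemma);
  T. Honda, J. Math. Soc. Japan 22 (1970), Lemma 2.4 — as cited by Blakestad–Grant for Lemma 5.

## Design notes

* `K = A[1/p]` is what makes the descent work (denominators are powers of `p`); Blakestad–Grant's
  series live in `R̂ ⊗ ℚ = R̂[1/p]`. Neither completeness of `A` nor injectivity of `α` is used.
* Pure proof file about Mathlib's `PowerSeries.subst` / `PowerSeries.map` / `PowerSeries.expand`.
-/

noncomputable section
noncomputable section

open PowerSeries

namespace Literature.RingTheory.FormalGroups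

variable {K : Type*} [CommRing K]

/-! ### Series with coefficients in a subring -/

section Subring

variable (A : Subring K)

/-- A series all of whose coefficients lie in the subring `A` comes from `A⟦X⟧`. [folklore] -/
theorem exists_map_subtype_eq_of_coeff_mem {f : K⟦X⟧} (hf : ∀ n, coeff n f ∈ A) :
    ∃ F : A⟦X⟧, F.map A.subtype = f :=
  ⟨PowerSeries.mk fun n => ⟨coeff n f, hf n⟩, by ext n; simp⟩

/-- Coefficients of a series mapped from `A⟦X⟧` lie in `A`. [folklore] -/
theorem coeff_map_subtype_mem (F : A⟦X⟧) (n : ℕ) : coeff n (F.map A.subtype) ∈ A := by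
  rw [coeff_map]; exact (coeff n F).2

end Subring

/-! ### Two coefficient computations -/

section Coeff

/-- The constant term of `f(φ)` is `f(0)` when `φ(0) = 0`. [folklore] -/
theorem constantCoeff_subst_of_constantCoeff_eq_zero {φ : K⟦X⟧} (hφ : constantCoeff φ = 0)
    (f : K⟦X⟧) : constantCoeff (f.subst φ) = constantCoeff f := by
  rw [← coeff_zero_eq_constantCoeff_apply, coeff_subst' (HasSubst.of_constantCoeff_zero' hφ),
    finsum_eq_single _ 0]
  · simp
  · intro d hd
    rw [coeff_zero_eq_constantCoeff_apply, map_pow, hφ, zero_pow hd, smul_zero]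

/-- If `φ(0) = 0` then the coefficient of `Xⁿ` in `φⁿ · G` is `φ'(0)ⁿ · G(0)`. [folklore] -/
theorem coeff_pow_mul_of_constantCoeff_eq_zero {φ : K⟦X⟧} (hφ : constantCoeff φ = 0)
    (G : K⟦X⟧) (n : ℕ) : coeff n (φ ^ n * G) = coeff 1 φ ^ n * constantCoeff G := by
  obtain ⟨ψ, hψ⟩ : X ∣ φ := by rwa [X_dvd_iff]
  have h1 : coeff 1 φ = constantCoeff ψ := by
    rw [hψ, ← pow_one (X : K⟦X⟧), coeff_X_pow_mul', if_pos le_rfl, Nat.sub_self,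
      coeff_zero_eq_constantCoeff_apply]
  rw [h1, hψ, mul_pow, mul_assoc, coeff_X_pow_mul', if_pos le_rfl, Nat.sub_self,
    coeff_zero_eq_constantCoeff_apply, map_mul, map_pow]

/-- `map g ∘ map f = map (g ∘ f)` on `R⟦X⟧`, pointwise. [folklore] -/
theorem map_map_apply {R S T : Type*} [CommRing R] [CommRing S] [CommRing T] (f : R →+* S)
    (g : S →+* T) (φ : R⟦X⟧) : map g (map f φ) = map (g.comp f) φ := by
  rw [map_comp]; rfl

/-- `PowerSeries.map_subst`, with `PowerSeries.map` on the left. [folklore] -/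
theorem map_subst_apply {R S : Type*} [CommRing R] [CommRing S] {a : R⟦X⟧} (ha : HasSubst a)
    (h : R →+* S) (f : R⟦X⟧) : map h (f.subst a) = (f.map h).subst (a.map h) :=
  map_subst ha f

end Coeff

/-! ### The descent step -/

section Descent

/-- **Descent.** If `K = A[1/p]`, `α(A) ⊆ A`, and `x ∈ K` satisfies `x = a + p^{m+1} c α(x)` with
`a, c ∈ A`, then `x ∈ A`: if `pᵏ⁺¹x ∈ A` then `pᵏx = pᵏa + pᵐ c α(pᵏ⁺¹x) ∈ A`. [folklore] -/
theorem mem_of_eq_add_pow_mul_map (p : ℕ) (A : Subring K) (α : K →+* K)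
    (hK : ∀ x : K, ∃ k : ℕ, (p : K) ^ k * x ∈ A) (hαA : ∀ r ∈ A, α r ∈ A)
    {x a c : K} (ha : a ∈ A) (hc : c ∈ A) (m : ℕ)
    (hx : x = a + (p : K) ^ (m + 1) * c * α x) : x ∈ A := by
  obtain ⟨k, hk⟩ := hK x
  induction k with
  | zero => simpa using hk
  | succ k ih =>
    apply ih
    have h : (p : K) ^ k * x = (p : K) ^ k * a + (p : K) ^ m * c * α ((p : K) ^ (k + 1) * x) := by
      rw [map_mul, map_pow, map_natCast]
      conv_lhs => rw [hx]
      ring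
    rw [h]
    exact add_mem (mul_mem (pow_mem (natCast_mem A p) k) ha)
      (mul_mem (mul_mem (pow_mem (natCast_mem A p) m) hc) (hαA _ hk))

end Descent

/-! ### Reduction modulo `p`: Frobenius -/

section ModP

variable (p : ℕ) (A : Subring K)

/-- Membership in `pA`, read in `K`. [folklore] -/
theorem exists_eq_mul_of_mem_span {r : A} (hr : r ∈ Ideal.span {(p : A)}) :
    ∃ a ∈ A, (r : K) = p * a := by
  obtain ⟨b, hb⟩ := Ideal.mem_span_singleton'.mp hr
  exact ⟨b, b.2, by rw [← hb]; push_cast; ring⟩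

/-- If every coefficient of `D ∈ A⟦X⟧` vanishes modulo `p`, then every coefficient of `D`, read in
`K`, is `p` times an element of `A`. [folklore] -/
theorem exists_coeff_eq_mul_of_map_mk_eq_zero {D : A⟦X⟧}
    (hD : D.map (Ideal.Quotient.mk (Ideal.span {(p : A)})) = 0) (n : ℕ) :
    ∃ a ∈ A, coeff n (D.map A.subtype) = p * a := by
  have h : Ideal.Quotient.mk (Ideal.span {(p : A)}) (coeff n D) = 0 := by
    rw [← coeff_map, hD, map_zero]
  rw [coeff_map]
  exact exists_eq_mul_of_mem_span p A (Ideal.Quotient.eq_zero_iff_mem.mp h)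

/-- **Frobenius modulo `p`.** For `Q ∈ A⟦X⟧` and a ring endomorphism `β` of `A` with
`β(r) ≡ rᵖ (mod p)`: `(β_* Q)(Xᵖ) ≡ Qᵖ (mod p)`. [folklore] -/
theorem map_mk_subst_X_pow_map_eq_pow [hp : Fact p.Prime] (hunit : ¬ IsUnit ((p : ℕ) : A))
    (β : A →+* A) (hβ : ∀ r : A, β r - r ^ p ∈ (Ideal.span {(p : A)})) (Q : A⟦X⟧) :
    PowerSeries.map (Ideal.Quotient.mk (Ideal.span {(p : A)})) ((Q.map β).subst (X ^ p : A⟦X⟧)) =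
      (Q.map (Ideal.Quotient.mk (Ideal.span {(p : A)}))) ^ p := by
  haveI : CharP (A ⧸ (Ideal.span {(p : A)})) p := CharP.quotient A p hunit
  haveI : ExpChar (A ⧸ (Ideal.span {(p : A)})) p := ExpChar.prime hp.out
  have hcomp : (Ideal.Quotient.mk (Ideal.span {(p : A)})).comp β =
      (frobenius (A ⧸ Ideal.span {(p : A)}) p).comp (Ideal.Quotient.mk (Ideal.span {(p : A)})) := by
    ext r
    rw [RingHom.comp_apply, RingHom.comp_apply, frobenius_def, ← map_pow, Ideal.Quotient.eq]
    exact hβ r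
  rw [map_subst_apply (HasSubst.X_pow hp.out.ne_zero), map_pow, map_X, map_map_apply, hcomp,
    ← map_map_apply, ← expand_apply p hp.out.ne_zero, ← map_expand]
  exact MvPowerSeries.map_frobenius_expand p hp.out.ne_zero

end ModP

/-! ### Dwork's lemma with a Frobenius endomorphism and a Frobenius lift -/

section Dwork

variable (p : ℕ) [hp : Fact p.Prime] (A : Subring K) (α : K →+* K)

/-- **Dwork's integrality lemma, with a Frobenius endomorphism of the coefficients and a
Frobenius lift of the variable.** Let `A ⊆ K` be a subring with `K = A[1/p]` (`p` a unit of `K`,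
every element of `K` is `p⁻ᵏ` times an element of `A`), `α` a ring endomorphism of `K` with
`α(A) ⊆ A` and `α(r) ≡ rᵖ (mod pA)` on `A`, and `φ ∈ A⟦X⟧` with `φ ≡ Xᵖ (mod pA⟦X⟧)`,
`φ(0) = 0`. If `s ∈ 1 + XK⟦X⟧` has `[X¹]s ∈ A` and `(α_* s)(φ) = sᵖ · u` with
`u ∈ 1 + pXA⟦X⟧`, then `s ∈ A⟦X⟧`. (For `A = ℤ_p`, `α = id`, `φ = Xᵖ` this is Dwork's lemma,
Koblitz GTM 58, Ch. IV §2 Lemma 3; the present form is the one behind Hazewinkel's functional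
equation lemma as used by Blakestad–Grant 2023, Lemma 5 and Cor. 6.) Proof: Koblitz's coefficient
induction — modulo `p`, `(α_* s_{<n})(φ) ≡ (α_* s_{<n})(Xᵖ) ≡ s_{<n}ᵖ`, and the coefficient of
`Xⁿ` reads `p sₙ ≡ pⁿ φ₁ⁿ α(sₙ) (mod pA)`, whence `sₙ ∈ A` by descent on the power of `p` in the
denominator. [cite: Koblitz1984, Ch. IV §2 Lemma 3] -/
theorem coeff_mem_of_map_subst_eq_pow_mul
    (hpK : IsUnit ((p : ℕ) : K)) (hK : ∀ x : K, ∃ k : ℕ, (p : K) ^ k * x ∈ A)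
    (hαA : ∀ r ∈ A, α r ∈ A) (hα : ∀ r ∈ A, ∃ a ∈ A, α r = r ^ p + p * a)
    {φ : K⟦X⟧} (hφ0 : constantCoeff φ = 0)
    (hφ : ∀ n, ∃ a ∈ A, coeff n φ = (if n = p then 1 else 0) + p * a)
    {s u : K⟦X⟧} (hs0 : constantCoeff s = 1) (hs1 : coeff 1 s ∈ A)
    (hu0 : constantCoeff u = 1) (hu : ∀ n, ∃ a ∈ A, coeff (n + 1) u = p * a)
    (heq : (s.map α).subst φ = s ^ p * u) :
    ∀ n, coeff n s ∈ A := by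
  -- the degenerate case: `p` is a unit of `A`, so `A = K`
  by_cases hunit : IsUnit ((p : ℕ) : A)
  · intro n
    obtain ⟨k, hk⟩ := hK (coeff n s)
    obtain ⟨v, hv⟩ := hunit
    have h1 : ((↑(v⁻¹ : Aˣ) : A) : K) ^ k * ((p : K) ^ k * coeff n s) = coeff n s := by
      rw [← mul_assoc, ← mul_pow, show (p : K) = ((v : A) : K) by rw [hv]; rfl, ← Subring.coe_mul,
        Units.inv_mul, Subring.coe_one, one_pow, one_mul]
    rw [← h1]
    exact mul_mem (pow_mem (SetLike.coe_mem _) k) hk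
  haveI : CharP (A ⧸ (Ideal.span {(p : A)})) p := CharP.quotient A p hunit
  have hp0 : ((p : ℕ) : A ⧸ (Ideal.span {(p : A)})) = 0 :=
    CharP.cast_eq_zero (A ⧸ (Ideal.span {(p : A)})) p
  -- integral lifts of `φ` and `u`; the restriction of `α` to `A`
  have hφA : ∀ n, coeff n φ ∈ A := fun n => by
    obtain ⟨a, ha, h⟩ := hφ n
    rw [h]
    split_ifs
    · exact add_mem (one_mem A) (mul_mem (natCast_mem A p) ha)
    · exact add_mem (zero_mem A) (mul_mem (natCast_mem A p) ha)
  have huA : ∀ n, coeff n u ∈ A := fun n => by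
    cases n with
    | zero => rw [coeff_zero_eq_constantCoeff_apply, hu0]; exact one_mem A
    | succ n => obtain ⟨a, ha, h⟩ := hu n; rw [h]; exact mul_mem (natCast_mem A p) ha
  obtain ⟨Φ, hΦ⟩ := exists_map_subtype_eq_of_coeff_mem A hφA
  obtain ⟨U, hU⟩ := exists_map_subtype_eq_of_coeff_mem A huA
  set β : A →+* A := α.restrict A A hαA with hβdef
  have hβα : A.subtype.comp β = α.comp A.subtype := RingHom.ext fun r => rfl
  have hβ : ∀ r : A, β r - r ^ p ∈ (Ideal.span {(p : A)}) := fun r => by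
    obtain ⟨a, ha, h⟩ := hα r r.2
    refine Ideal.mem_span_singleton'.mpr ⟨⟨a, ha⟩, Subtype.ext ?_⟩
    change (a : K) * (p : A) = α r - (r : K) ^ p
    rw [h]; push_cast; ring
  have hΦ0 : constantCoeff Φ = 0 := by
    apply A.subtype_injective
    rw [← coeff_zero_eq_constantCoeff_apply, ← coeff_map, hΦ, coeff_zero_eq_constantCoeff_apply,
      hφ0, map_zero]
  have hΦp : Φ.map (Ideal.Quotient.mk (Ideal.span {(p : A)})) =
      (X : (A ⧸ (Ideal.span {(p : A)}))⟦X⟧) ^ p := by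
    ext n
    rw [coeff_map, coeff_X_pow]
    obtain ⟨a, ha, h⟩ := hφ n
    have hc : coeff n Φ = (if n = p then 1 else 0) + (p : A) * ⟨a, ha⟩ := by
      apply A.subtype_injective
      rw [← coeff_map, hΦ, h]
      split_ifs <;> rfl
    rw [hc, map_add, map_mul, map_natCast, hp0, zero_mul, add_zero]
    split_ifs <;> simp
  have hUp : U.map (Ideal.Quotient.mk (Ideal.span {(p : A)})) = 1 := by
    ext n
    rw [coeff_map, coeff_one]
    cases n with
    | zero =>
      have : coeff 0 U = 1 := by
        apply A.subtype_injective
        rw [← coeff_map, hU, coeff_zero_eq_constantCoeff_apply, hu0]; rfl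
      rw [this, map_one, if_pos rfl]
    | succ n =>
      obtain ⟨a, ha, h⟩ := hu n
      have : coeff (n + 1) U = (p : A) * ⟨a, ha⟩ := by
        apply A.subtype_injective
        rw [← coeff_map, hU, h]; rfl
      rw [this, map_mul, map_natCast, hp0, zero_mul, if_neg (Nat.succ_ne_zero n)]
  -- `φ₁ = p a₁`
  obtain ⟨a₁, ha₁, hφ1⟩ := hφ 1
  rw [if_neg (hp.out.one_lt.ne)] at hφ1
  rw [zero_add] at hφ1
  -- strong induction on `n`
  intro n
  induction n using Nat.strong_induction_on with
  | _ n ih =>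
    rcases Nat.lt_or_ge n 2 with hn | hn
    · interval_cases n
      · rw [coeff_zero_eq_constantCoeff_apply, hs0]; exact one_mem A
      · exact hs1
    obtain ⟨m, rfl⟩ : ∃ m, n = m + 2 := ⟨n - 2, by omega⟩
    -- the truncation `q = s_{<n}` and its integral lift `Q`
    set Q : A⟦X⟧ := PowerSeries.mk fun i => if h : i < m + 2 then ⟨coeff i s, ih i h⟩ else 0
      with hQdef
    set q : K⟦X⟧ := Q.map A.subtype with hqdef
    have hq_lt : ∀ i, i < m + 2 → coeff i q = coeff i s := fun i hi => by
      rw [hqdef, coeff_map, hQdef, coeff_mk, dif_pos hi]; rfl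
    have hq_ge : ∀ i, m + 2 ≤ i → coeff i q = 0 := fun i hi => by
      rw [hqdef, coeff_map, hQdef, coeff_mk, dif_neg (not_lt.mpr hi)]; rfl
    have hq0 : constantCoeff q = 1 := by
      rw [← coeff_zero_eq_constantCoeff_apply, hq_lt 0 (by omega),
        coeff_zero_eq_constantCoeff_apply, hs0]
    -- `s = q + Xⁿ r`, `r(0) = sₙ`
    obtain ⟨r, hr⟩ : (X : K⟦X⟧) ^ (m + 2) ∣ s - q := by
      rw [X_pow_dvd_iff]
      intro i hi
      rw [map_sub, hq_lt i hi, sub_self]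
    have hr0 : constantCoeff r = coeff (m + 2) s := by
      have := congrArg (coeff (m + 2)) hr
      rw [map_sub, hq_ge _ le_rfl, sub_zero, coeff_X_pow_mul', if_pos le_rfl, Nat.sub_self,
        coeff_zero_eq_constantCoeff_apply] at this
      exact this.symm
    have hs : s = q + X ^ (m + 2) * r := by rw [← hr]; ring
    -- (a) the left-hand side at `Xⁿ`
    have hφsub : HasSubst φ := HasSubst.of_constantCoeff_zero' hφ0
    have hL : coeff (m + 2) ((s.map α).subst φ) =
        coeff (m + 2) ((q.map α).subst φ) + (p * a₁) ^ (m + 2) * α (coeff (m + 2) s) := by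
      have e : (s.map α).subst φ = (q.map α).subst φ + φ ^ (m + 2) * (r.map α).subst φ := by
        conv_lhs => rw [hs]
        rw [map_add, map_mul, map_pow, map_X, subst_add hφsub, subst_mul hφsub, subst_pow hφsub,
          subst_X hφsub]
      rw [e, map_add, coeff_pow_mul_of_constantCoeff_eq_zero hφ0,
        constantCoeff_subst_of_constantCoeff_eq_zero hφ0, ← coeff_zero_eq_constantCoeff_apply,
        coeff_map, coeff_zero_eq_constantCoeff_apply, hr0, hφ1]
    -- (b) the right-hand side at `Xⁿ`
    have hR : coeff (m + 2) (s ^ p * u) = coeff (m + 2) (q ^ p * u) + p * coeff (m + 2) s := by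
      have hgeom := geom_sum₂_mul s q p
      have hT0 : constantCoeff ((Finset.range p).sum fun i => s ^ i * q ^ (p - 1 - i)) = p := by
        rw [map_sum, Finset.sum_congr rfl fun i _ => by rw [map_mul, map_pow, map_pow, hs0, hq0,
          one_pow, one_pow, one_mul], Finset.sum_const, Finset.card_range, nsmul_eq_mul, mul_one]
      have : s ^ p * u = q ^ p * u + X ^ (m + 2) *
          (r * ((Finset.range p).sum fun i => s ^ i * q ^ (p - 1 - i)) * u) := by
        have hsq : s - q = X ^ (m + 2) * r := hr
        calc s ^ p * u = q ^ p * u + (s ^ p - q ^ p) * u := by ring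
          _ = q ^ p * u +
              ((Finset.range p).sum fun i => s ^ i * q ^ (p - 1 - i)) * (s - q) * u := by
            rw [hgeom]
          _ = _ := by rw [hsq]; ring
      rw [this, map_add, coeff_X_pow_mul', if_pos le_rfl, Nat.sub_self,
        coeff_zero_eq_constantCoeff_apply, map_mul constantCoeff, map_mul constantCoeff, hr0, hT0,
        hu0]
      ring
    -- (c) the truncated parts agree modulo `p`
    have hC : ∃ a ∈ A, coeff (m + 2) ((q.map α).subst φ) - coeff (m + 2) (q ^ p * u) = p * a := by
      have hD : PowerSeries.map A.subtype ((Q.map β).subst Φ - Q ^ p * U) =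
          (q.map α).subst φ - q ^ p * u := by
        rw [map_sub, map_mul, map_pow, hU, ← hqdef,
          map_subst_apply (HasSubst.of_constantCoeff_zero' hΦ0), map_map_apply, hβα,
          ← map_map_apply, ← hqdef, hΦ]
      have hD0 : PowerSeries.map (Ideal.Quotient.mk (Ideal.span {(p : A)}))
          ((Q.map β).subst Φ - Q ^ p * U) = 0 := by
        rw [map_sub, map_mul, map_pow, hUp, mul_one,
          map_subst_apply (HasSubst.of_constantCoeff_zero' hΦ0), hΦp, sub_eq_zero]
        have := map_mk_subst_X_pow_map_eq_pow p A hunit β hβ Q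
        rwa [map_subst_apply (HasSubst.X_pow hp.out.ne_zero), map_pow, map_X] at this
      obtain ⟨a, ha, h⟩ := exists_coeff_eq_mul_of_map_mk_eq_zero p A hD0 (m + 2)
      refine ⟨a, ha, ?_⟩
      rw [← h, hD, map_sub]
    -- (d) assemble: `p sₙ = p a + pⁿ a₁ⁿ α(sₙ)`
    obtain ⟨a, ha, hC⟩ := hC
    have hkey : (p : K) * (coeff (m + 2) s - (a + (p : K) ^ (m + 1) * a₁ ^ (m + 2) *
        α (coeff (m + 2) s))) = 0 := by
      have := congrArg (coeff (m + 2)) heq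
      rw [hL, hR] at this
      linear_combination hC - this
    have hx : coeff (m + 2) s = a + (p : K) ^ (m + 1) * a₁ ^ (m + 2) * α (coeff (m + 2) s) := by
      have := hpK.mul_right_eq_zero.mp hkey
      rwa [sub_eq_zero] at this
    exact mem_of_eq_add_pow_mul_map p A α hK hαA ha (pow_mem ha₁ _) m hx

end Dwork

end Literature.RingTheory.FormalGroups
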